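import Mathlib
import Summits.Ventures.PercRepro2.TB14Series

/-!
# The unified favourable-conditioning statement `TBFav` (a named candidate, not a theorem)
(blind cell PercRepro2, mine-c g19, 2026-08-25; `conjectures/MINE-C.md` §28.9)

Two copies at a profile «`F` free, `z` pinned» (`A3InactiveTyped.pairCount`): copy `y` is RED,
copy `w = flipOn F y` is BLUE; `K_r = C_y(a₁)`, `K_b = C_w(a₁)`, `M_r = C_y(a₂)`, `M_b = C_w(a₂)`,
`Q = {a₁ ↮ a₂}` in both copies, `ε_o = 1[o ∈ M_r] − 1[o ∈ M_b]`.

The four FAVOURABLE single-vertex events of a vertex `v` are `v ∈ K_b`, `v ∈ M_r`, `v ∉ K_r`,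
`v ∉ M_b` (`FavCon`).  The CANDIDATE `TBFav` (one seat, exact census: every graph with ≤ 7 vertices
for ≤ 3 constrained vertices at `m ≤ 10..12`, every two-connected 8-vertex graph with `m ≤ 13` for
one constrained vertex, every profile at `n ≤ 5` and all free / pinned-open profiles at `n = 6`,
`m ≤ 9`; 23,794 random instances with 9–11 vertices; 0 failures) says: for ANY finite set `S` of
vertices, each carrying ANY subset of the favourable events,

  `0 ≤ Σ_Q Π_{v ∈ S} 1[the favourable events of v hold] · ε_o`   (`pairCount F z (favK …)`).

Special cases: `S = {b}` with the single event `b ∈ K_b` is row 2′TB — typed BHK 1.4 for single-vertex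
events (`TB14_of_TBFav`); with `b ∈ K_b, b ∉ K_r` the exclusive form; `b ∈ M_r` is the companion row
2′TB13 at the avoid set `{a₁}`; `b ∈ K_b, b ∈ M_r` the junction class; two vertices `b ∈ K_b`,
`y ∈ M_r` the mixed statement.  The events `v ∉ K_r` and `v ∈ K_b` (resp. `v ∉ M_b` and `v ∈ M_r`)
give the same count for a single constrained vertex (`pairCount_favK_notKr`, `pairCount_favK_notMb`,
by the colour swap); with no constrained vertex the count is `0` (`pairCount_favK_empty`).
Own work; standard axioms; no proof of the candidate is claimed.
-/

namespace Summit.Ventures.PercRepro2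

namespace FavCond

open CovForm A3InactiveTyped TB14Cut

/-- A favourable constraint on a vertex: which of the four favourable events are required
(`inKb`: `v ∈ K_b`; `inMr`: `v ∈ M_r`; `notKr`: `v ∉ K_r`; `notMb`: `v ∉ M_b`). -/
structure FavCon where
  inKb : Bool
  inMr : Bool
  notKr : Bool
  notMb : Bool

/-- The constraint «`v ∈ K_b`» alone (the mark of row 2′TB in the non-exclusive form). -/
def FavCon.mark : FavCon := ⟨true, false, false, false⟩

/-- The constraint «`v ∉ K_r`» alone. -/
def FavCon.notKrOnly : FavCon := ⟨false, false, true, false⟩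

/-- The constraint «`v ∈ M_r`» alone (the mark of row 2′TB13 at the avoid set `{a₁}`). -/
def FavCon.markM : FavCon := ⟨false, true, false, false⟩

/-- The constraint «`v ∉ M_b`» alone. -/
def FavCon.notMbOnly : FavCon := ⟨false, false, false, true⟩

section Kernel

variable {V : Type*} {E : Type*} {R : Type*} [Field R]

/-- The indicator of the favourable constraint `c` at the vertex `v` on the copy pair `(y, w)`:
`1[v ∈ C_w(a₁)]^{inKb} · 1[v ∈ C_y(a₂)]^{inMr} · (1 − 1[v ∈ C_y(a₁)])^{notKr} · (1 − 1[v ∈ C_w(a₂)])^{notMb}`. -/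
noncomputable def favInd (ends : E → Sym2 V) (a₁ a₂ : V) (c : FavCon) (v : V) :
    Config E → Config E → R :=
  fun y w =>
    (if c.inKb then iL ends a₁ v w else 1) * (if c.inMr then iH ends a₂ v y else 1) *
      (if c.notKr then 1 - iL ends a₁ v y else 1) * (if c.notMb then 1 - iH ends a₂ v w else 1)

/-- **The favourable kernel**: `1_Q(y) 1_Q(w) · Π_{v ∈ S} favInd (c v) v · (1[o ∈ C_y(a₂)] − 1[o ∈ C_w(a₂)])`. -/
noncomputable def favK (ends : E → Sym2 V) (a₁ a₂ o : V) (S : Finset V) (c : V → FavCon) :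
    Config E → Config E → R :=
  fun y w => iQ ends a₁ a₂ y * iQ ends a₁ a₂ w * (∏ v ∈ S, favInd ends a₁ a₂ (c v) v y w) *
    (iH ends a₂ o y - iH ends a₂ o w)

end Kernel

/-- **(TB-FAV), the unified favourable-conditioning candidate** (a Prop; NOT a theorem): at every
profile, for every finite graph, roots `a₁, a₂`, vertex `o`, finite set `S` of constrained vertices
and assignment `c` of favourable constraints, the two-copy count of the favourable kernel is
nonnegative. -/
def TBFav (R : Type*) [Field R] [LinearOrder R] : Prop :=
  ∀ (V E : Type) [Fintype V] [DecidableEq V] [Fintype E] [DecidableEq E] (ends : E → Sym2 V)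
    (a₁ a₂ o : V) (S : Finset V) (c : V → FavCon) (F : Finset E) (z : Config E),
    0 ≤ pairCount F z (favK ends a₁ a₂ o S c : Config E → Config E → R)

section Reductions

variable {V : Type} {E : Type} [Fintype E] [DecidableEq E] {R : Type*} [Field R]

omit [Fintype E] [DecidableEq E] in
/-- With the single constraint «`b ∈ K_b`» the favourable kernel is the folded (TB14) kernel with the
copies exchanged. -/
lemma favK_single_mark [DecidableEq V] (ends : E → Sym2 V) (a₁ a₂ b o : V) (y w : Config E) :
    (favK ends a₁ a₂ o {b} (fun _ => FavCon.mark) y w : R) = foldK ends a₁ a₂ b o w y := by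
  simp only [favK, favInd, FavCon.mark, foldK, Finset.prod_singleton, Bool.false_eq_true, ↓reduceIte]
  ring

/-- The count of the single-mark favourable kernel is the (TB14) slack. -/
lemma pairCount_favK_single_mark [DecidableEq V] (ends : E → Sym2 V) (a₁ a₂ b o : V)
    (F : Finset E) (z : Config E) :
    pairCount F z (favK ends a₁ a₂ o {b} (fun _ => FavCon.mark) : Config E → Config E → R) =
      pairCount F z (foldK ends a₁ a₂ b o) := by
  rw [pairCount_swap]
  congr 1
  funext y w
  exact favK_single_mark ends a₁ a₂ b o w y

/-- **Row 2′TB is the single-mark case of (TB-FAV).** -/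
theorem TB14_of_TBFav [LinearOrder R] [IsStrictOrderedRing R] (h : TBFav R) : TB14 R := by
  intro V E _ _ _ _ ends a₁ a₂ b o F z
  have h1 := h V E ends a₁ a₂ o {b} (fun _ => FavCon.mark) F z
  rw [pairCount_favK_single_mark, ← slack_eq_pairCount_foldK] at h1
  exact sub_nonneg.1 h1

/-- A swap-antisymmetric kernel has count `0`. -/
lemma pairCount_eq_zero_of_antisymm' [LinearOrder R] [IsStrictOrderedRing R] (F : Finset E)
    (z : Config E) (Φ : Config E → Config E → R) (hΦ : ∀ y w, Φ w y = -Φ y w) :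
    pairCount F z Φ = 0 := by
  have h1 : pairCount F z Φ = pairCount F z (fun y w => Φ w y) := pairCount_swap F z Φ
  have h2 : pairCount F z (fun y w => Φ w y) = pairCount F z (fun y w => -Φ y w) := by
    congr 1; funext y w; exact hΦ y w
  have h3 : pairCount F z (fun y w => -Φ y w) = -pairCount F z Φ := by
    have := pairCount_const_mul F z (-1 : R) Φ
    simp only [neg_one_mul] at this
    rw [this]
  have h4 : pairCount F z Φ = -pairCount F z Φ := h1.trans (h2.trans h3)
  linarith

/-- With no constrained vertex the favourable count is `0` (the kernel is swap-antisymmetric). -/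
lemma pairCount_favK_empty [LinearOrder R] [IsStrictOrderedRing R] (ends : E → Sym2 V)
    (a₁ a₂ o : V) (c : V → FavCon) (F : Finset E) (z : Config E) :
    pairCount F z (favK ends a₁ a₂ o ∅ c : Config E → Config E → R) = 0 := by
  apply pairCount_eq_zero_of_antisymm'
  intro y w
  simp only [favK, Finset.prod_empty]
  ring

/-- **«`v ∉ K_r`» and «`v ∈ K_b`» give the same count** for a single constrained vertex
(colour swap: `Σ_Q 1[v ∈ K_r] ε_o = − Σ_Q 1[v ∈ K_b] ε_o`, and `Σ_Q ε_o = 0`). -/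
lemma pairCount_favK_notKr [DecidableEq V] [LinearOrder R] [IsStrictOrderedRing R]
    (ends : E → Sym2 V) (a₁ a₂ v o : V) (F : Finset E) (z : Config E) :
    pairCount F z (favK ends a₁ a₂ o {v} (fun _ => FavCon.notKrOnly) : Config E → Config E → R) =
      pairCount F z (favK ends a₁ a₂ o {v} (fun _ => FavCon.mark)) := by
  -- favK(notKr) = favK(∅) − Ψ with Ψ y w = iQ y iQ w iL(v, y) (iH o y − iH o w),
  -- and Ψ(w, y) = − favK(mark)(y, w).
  have hsplit : ∀ y w : Config E,
      (favK ends a₁ a₂ o {v} (fun _ => FavCon.notKrOnly) y w : R) =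
        favK ends a₁ a₂ o ∅ (fun _ => FavCon.mark) y w -
          (- favK ends a₁ a₂ o {v} (fun _ => FavCon.mark) w y) := by
    intro y w
    simp only [favK, favInd, FavCon.notKrOnly, FavCon.mark, Finset.prod_singleton,
      Finset.prod_empty, Bool.false_eq_true, ↓reduceIte]
    ring
  have h1 : pairCount F z (favK ends a₁ a₂ o {v} (fun _ => FavCon.notKrOnly) :
      Config E → Config E → R) =
      pairCount F z (favK ends a₁ a₂ o ∅ (fun _ => FavCon.mark)) -
        pairCount F z (fun y w => - favK ends a₁ a₂ o {v} (fun _ => FavCon.mark) w y) := by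
    rw [← pairCount_sub]
    congr 1
    funext y w
    exact hsplit y w
  have h2 : pairCount F z (fun y w => - favK ends a₁ a₂ o {v} (fun _ => FavCon.mark) w y :
      Config E → Config E → R) = - pairCount F z (favK ends a₁ a₂ o {v} (fun _ => FavCon.mark)) := by
    have hc := pairCount_const_mul F z (-1 : R)
      (fun y w => favK ends a₁ a₂ o {v} (fun _ => FavCon.mark) w y)
    simp only [neg_one_mul] at hc
    rw [hc, ← pairCount_swap]
  rw [h1, h2, pairCount_favK_empty]
  ring

/-- **«`v ∉ M_b`» and «`v ∈ M_r`» give the same count** for a single constrained vertex (the same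
swap on the `a₂` side). -/
lemma pairCount_favK_notMb [DecidableEq V] [LinearOrder R] [IsStrictOrderedRing R]
    (ends : E → Sym2 V) (a₁ a₂ v o : V) (F : Finset E) (z : Config E) :
    pairCount F z (favK ends a₁ a₂ o {v} (fun _ => FavCon.notMbOnly) : Config E → Config E → R) =
      pairCount F z (favK ends a₁ a₂ o {v} (fun _ => FavCon.markM)) := by
  have hsplit : ∀ y w : Config E,
      (favK ends a₁ a₂ o {v} (fun _ => FavCon.notMbOnly) y w : R) =
        favK ends a₁ a₂ o ∅ (fun _ => FavCon.markM) y w -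
          (- favK ends a₁ a₂ o {v} (fun _ => FavCon.markM) w y) := by
    intro y w
    simp only [favK, favInd, FavCon.notMbOnly, FavCon.markM, Finset.prod_singleton,
      Finset.prod_empty, Bool.false_eq_true, ↓reduceIte]
    ring
  have h1 : pairCount F z (favK ends a₁ a₂ o {v} (fun _ => FavCon.notMbOnly) :
      Config E → Config E → R) =
      pairCount F z (favK ends a₁ a₂ o ∅ (fun _ => FavCon.markM)) -
        pairCount F z (fun y w => - favK ends a₁ a₂ o {v} (fun _ => FavCon.markM) w y) := by
    rw [← pairCount_sub]
    congr 1
    funext y w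
    exact hsplit y w
  have h2 : pairCount F z (fun y w => - favK ends a₁ a₂ o {v} (fun _ => FavCon.markM) w y :
      Config E → Config E → R) = - pairCount F z (favK ends a₁ a₂ o {v} (fun _ => FavCon.markM)) := by
    have hc := pairCount_const_mul F z (-1 : R)
      (fun y w => favK ends a₁ a₂ o {v} (fun _ => FavCon.markM) w y)
    simp only [neg_one_mul] at hc
    rw [hc, ← pairCount_swap]
  rw [h1, h2, pairCount_favK_empty]
  ring

end Reductions

end FavCond

end Summit.Ventures.PercRepro2
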